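import Literature.MathematicalPhysics.QuantumFieldTheory.Balaban1983to89.B8Ineq192MultiLevelTorusL0
import Literature.MathematicalPhysics.QuantumFieldTheory.Balaban1983to89.B6Ineq2134ThetaKLevel
import Literature.MathematicalPhysics.QuantumFieldTheory.Balaban1983to89.B6Ineq2134KLevelTorus

/-!
# `Balaban1983to89.B6Ineq2134KLevelTorusL0` — LEVEL-0 TWIN (programme G-F3′-L0, director-ym LINE №27 / UV3-NODE §24.5; plan `lit-balaban-r03/G-F3L0-PLAN.md`) of `B6Ineq2134KLevelTorus`:
the same declarations, SAME NAMES AND STATEMENTS, for nested families WITH print's region `Λ₀ = T ∖ Ω₁` ADMITTED (structures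
`B6MultiLevelBoxOperatorL0.Domains` / `B6MultiLevelTorusOperatorL0.TDomains`: levels `0, …, k`, the level-`0` block a single site, `Q′₀ = id`,
finite weight `a₀` — print p.225 (2.14) «Σ_{j=0}^k … (Q′₀λ)(x) = λ(x), x ∈ Λ₀», p.229 «taking a sequence (2.1) … smallest possible domains B^j(Λ_j),
and considering the operator Δ_a defined by (2.19), (2.20) for this sequence»).  Every `D`-free object is the lineage's, consumed BY NAME; no existing
module is touched; no fact is minted.  Unit `lit-balaban-p33` (p33 gen 89; S-E entry twins named to p33 by the B6 owner r03 gen 36, ruling 2026-08-27T18:45:57Z; port tooling by r03 gen 36); B6 fold owner r03; referee ref-4.  THE TWIN'S DOCUMENTATION FOLLOWS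
VERBATIM (its «levels 1 … k» / «Ω₁ = X» sentences describe the twin; here `j` runs from `0` and `Ω₁` may be a proper subset).

# `Balaban1983to89.B6Ineq2134KLevelTorus` — T. Bałaban, *Propagators and renormalization transformations for lattice gauge theories. II*,
# Commun. Math. Phys. **96** (1984) 223–250 [Balaban1984PropagatorsII], Prop. 2.6 p. 247: THE SMALLNESS `θ₀ = O(M⁻¹)` OF (2.134) FOR `□ ≠ □′`,
# ON THE GENUINE MULTI-LEVEL TORUS `T_η` — the torus twin of `…B6Ineq2134ThetaKLevel` §3–§5: the walk inputs (2.60)/(2.63)/`L² ≤ e^{⅛δRM}` on B8's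
# census geometry `geomTB D` of a genuine nested family `D : TDomains` ON THE TORUS (p21's `lemma21_torus`, B8's `levelSepTB` by name), and (2.134) for the
# off-diagonal kernels `K_{□,□′} = h_□²(1 − ζ_{□′})∂P∂*h_{□′}` (2.93) on ANY fine lattice over the torus blocks, the global `∂P∂*` a displayed hypothesis

statement-level skeleton of published theorems with citation tags; proofs where landed; nothing here is a claim about the Yang–Mills mass gap

PDF held: `paper:balaban1984-cmp96-propagators-rt-ii` (journal page = PDF page + 222): p. 234 [PDF 12] (Lemma 2.1), p. 239 [PDF 17] ((2.91)–(2.93)), p. 247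
[PDF 25] ((2.134)); read from the tree transcriptions (`…B6Ineq2134OffDiag`, `…B6Ineq2134ThetaKLevel`).  PRINT p. 247: *"For □ ∩ □′ = ∅ … the bound of
G_□′ is multiplied by θ and we get the estimate |(K_{□,□′}G_{□′}h_{□′}J)(x)| ≤ θ₀e^{−½δ₂d(y,y′)}|J| … θ₀ = O(M^{−1})"*; p. 224 (2.1): the domains are
subsets of the TORUS `T_η` (p21's `TDomains`, files T1–T8).

CITATION HEADER (lean-in-tree rule) — WHAT IS REPRODUCED.  Phase-2 file of the `lit-balaban` typed skeleton (HOME `run/shared/lean/pub/lit-balaban/`), seat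
**p38 gen 25**; B6-CLOSURE §5 item 9 (r03 g18 close-out, 2026-08-22T23:34:17Z: *"(2.134) for the kFam family on `geomT`/`blkV1` [(d4): p38's
`h2134_kFam_kLevel` is the `geoB` twin; torus port …]"*), the TORUS PORT, file 1; SKELETON rows **B6.Eq2.134** × **B6.Lem2.1** × **B6.Eq2.93** ×
**B6.Prop2.6** (cells only; decls of record untouched; referee ref-4).  Gen 24's `…B6Ineq2134ThetaKLevel` did this on p21's BOX members `i : KIdx` with
P7's genuine `∂P∂*`; ROUTE V of the (d)-assembly lives on the torus (r03's `B6GlobalChartV1.prop26_2136_V1_of_2134_eq291` on `geomT D`, `blkV1`), where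
the multi-level `(Q′G′²Q′*)⁻¹`/(2.88) is not yet in the tree ((d2)).  THIS FILE, for every genuine nested family `D : TDomains d ℓ M_h k P R` on the torus
(`L = ℓ+1 ≥ 2`, `M = L·M_h`, `R ≥ 2L`, box sides `P_μ ≥ 1`) and B8's census geometry `geomTB D` (= p21's `geomT D` with `M := L·M_h`, `R := R − 1/(L·M_h)`;
SAME sites/`dist`/`len`/`L`, so every majorant below is verbatim a majorant on `geomT D`):
* §1 the side facts and THE WALK INPUTS ON THE TORUS: `one_le_L_TB`, `eta_pos_TB`, `M_pos_TB`, `RM_nonneg_TB`, `dist_nonneg_TB`; **`ineq263_geomTB`**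
  ((2.63) at `(¾δ, ⅓)` with `c = K261 N₀ (d+1) L 1 (¼δ)` for `L·M_h ≥ N₀ + 1`, from p21's `lemma21_torus`), **`thr_geomTB`** (`L² ≤ e^{⅛δ·RM}` for
  `L·M_h ≥ N₂ + 1`); (2.60) is B8's `levelSepTB` by name;
* §2 **`ineq2134_offDiag_torus`** / **`ineq2134_kOff_torus`**: for `δ_G > 0` ONE threshold `M₀` and ONE `Θ` (on `d, L, δ_G`) such that for every member
  with `L·M_h ≥ M₀`, every fine lattice `X` with block map `blk : X → 𝔅`, every `∂P∂*`-candidate `Dg` with majorant `C_P(L^j)^{−2}e^{−δ_Gd}` (HYPOTHESIS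
  `hDg`), every `G_{□′}` with the (2.133)-shape local majorant and partition data as in gen 24:
  `HasMajorant blk ((kOff Dg h ζ h′·G_{□′})·h′) (Θ·C_P·C_G/(m·M)·e^{−(δ_G/2)d})` — r03's `offDiag_hasMajorant` + `theta_le` at the rate `δ_G` itself;
* §3 `ineq2134_kOff_torus_small`: with gen 24's `theta0_lt`, `N²θ₀c₁ < 1` above one threshold.
No `def`, no new fact; standard axioms.  The diagonal pairs and the `kFam` packaging (twins of `…B6Ineq2134DiagKLevel`/`…KFamKLevel`) are file 2 of the port.
HONEST SCOPE. (1) `∂P∂*` is NOT constructed here (hypothesis `hDg` in the (2.88) shape; on the box it is P7's theorem `hasMajorant_DP`); (2) lengths on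
`geomTB` are in LATTICE units (`η = 1`, `len y = L^j`), as in p21's torus census — consumers with physical units rescale; (3) constants `L`-dependent,
`k`/`M_h`-independent; integer torus; nothing on d = 4 or the continuum; NOT summit progress.  Unit `lit-balaban-p38` (gen 25), 2026-08-23.
-/

namespace Literature.MathematicalPhysics.QuantumFieldTheory.Balaban1983to89.B6Ineq2134KLevelTorusL0

open Literature.MathematicalPhysics.QuantumFieldTheory.Balaban1983to89.B6MultiLevelBoxOperator (N0 bigSide)
open Literature.MathematicalPhysics.QuantumFieldTheory.Balaban1983to89.B6MultiLevelTorusOperatorL0 (TDomains)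
open Literature.MathematicalPhysics.QuantumFieldTheory.Balaban1983to89.B6Geom246MultiLevelBoxL0 (bset)
open Literature.MathematicalPhysics.QuantumFieldTheory.Balaban1983to89.B6Geom246MultiLevelTorusL0 (geomT lemma21_torus triangle_refl_nonneg_T)
open Literature.MathematicalPhysics.QuantumFieldTheory.Balaban1983to89.B8Ineq192MultiLevelTorusL0 (geomTB geomTB_dist geomTB_len geomTB_L geomTB_eta geomTB_M geomTB_R geomTB_RM geomTB_RM_nonneg levelSepTB)
open Literature.MathematicalPhysics.QuantumFieldTheory.Balaban1983to89.B6Ineq261LevelGap (K261 theta_lt_one_of_log)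
open Literature.MathematicalPhysics.QuantumFieldTheory.Balaban1983to89.B6RandomWalk (HasMajorant hasMajorant_mono)
open Literature.MathematicalPhysics.QuantumFieldTheory.Balaban1983to89.B6Prop26Gluing (mulOp mulOp_apply LocalMajorant)
open Literature.MathematicalPhysics.QuantumFieldTheory.Balaban1983to89.B6Ineq268 (LevelSep)
open Literature.MathematicalPhysics.QuantumFieldTheory.Balaban1983to89.B6Lemma21Repaired (Ineq263With)
open Literature.MathematicalPhysics.QuantumFieldTheory.Balaban1983to89.B6Ineq2134OffDiag (offDiag_hasMajorant theta_le)
open Literature.MathematicalPhysics.QuantumFieldTheory.Balaban1983to89.B6Ineq2134ThetaKLevel (theta0_lt)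
open Literature.MathematicalPhysics.QuantumFieldTheory.Balaban1983to89.B6Eq291Generator (kOff)
open Literature.MathematicalPhysics.QuantumFieldTheory.Balaban1983to89.B6Ineq2134KLevelTorus (one_le_RLMh)

variable {d ℓ : ℕ}

/-! ## §1  Side facts and the walk inputs on the torus census geometry `geomTB D` -/

section Facts

variable {Mh k R : ℕ} {P : Fin (d + 1) → ℕ} (D : TDomains d ℓ Mh k P R)

/-- `L ≥ 1`. [cite: Balaban1984PropagatorsII, (2.1) p.224, bookkeeping] -/
theorem one_le_L_TB : 1 ≤ (B8Ineq192MultiLevelTorusL0.geomTB D).L := by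
  rw [geomTB_L]; linarith [(Nat.cast_nonneg ℓ : (0 : ℝ) ≤ ℓ)]

/-- `η = 1 > 0` (lattice units). [cite: Balaban1984PropagatorsII, (2.1) p.224, bookkeeping] -/
theorem eta_pos_TB : 0 < (B8Ineq192MultiLevelTorusL0.geomTB D).eta := by rw [geomTB_eta]; exact one_pos

/-- `M = L·M_h > 0`. [cite: Balaban1984PropagatorsII, (2.1) p.224, bookkeeping] -/
theorem M_pos_TB (hMh : 1 ≤ Mh) : 0 < (B8Ineq192MultiLevelTorusL0.geomTB D).M := by
  rw [geomTB_M]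
  have h1 : (1 : ℝ) ≤ (Mh : ℝ) := by exact_mod_cast hMh
  have h2 : (0 : ℝ) < (ℓ : ℝ) + 1 := by positivity
  nlinarith

/-- `R·M ≥ 0` on `geomTB`. [cite: Balaban1984PropagatorsII, (2.60) p.234, bookkeeping] -/
theorem RM_nonneg_TB (hMh : 1 ≤ Mh) (hR : 2 * (ℓ + 1) ≤ R) : 0 ≤ (B8Ineq192MultiLevelTorusL0.geomTB D).R * (geomTB D).M :=
  geomTB_RM_nonneg D hMh (one_le_RLMh hMh hR)

/-- `d ≥ 0` on the torus. [cite: Balaban1984PropagatorsII, (2.46) p.231, bookkeeping] -/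
theorem dist_nonneg_TB (hMh : 1 ≤ Mh) (hP : ∀ μ, 1 ≤ P μ) (y y' : (B8Ineq192MultiLevelTorusL0.geomTB D).Site) : 0 ≤ (geomTB D).dist y y' :=
  (triangle_refl_nonneg_T D hMh hP).2.2 y y'

/-- the member's threshold `L·M_h ≥ N + 1` gives the walk constant `R·L·M_h ≥ N + 1`. [cite: Balaban1984PropagatorsII, (2.59) p.233, bookkeeping] -/
private theorem walk_threshold (hR : 2 * (ℓ + 1) ≤ R) (N : ℕ) (hN : (N : ℝ) + 1 ≤ ((ℓ : ℝ) + 1) * Mh) : N + 1 ≤ R * ((ℓ + 1) * Mh) := by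
  have hR1 : 0 < R := by omega
  have h1 : ((N + 1 : ℕ) : ℝ) ≤ (((ℓ + 1) * Mh : ℕ) : ℝ) := by push_cast; exact hN
  have h2 : N + 1 ≤ (ℓ + 1) * Mh := by exact_mod_cast h1
  exact h2.trans (Nat.le_mul_of_pos_left _ hR1)

end Facts

/-- **(2.63) AT THE RATE `¾δ` WITH `α = ⅓` ON THE TORUS** — the `y″`-sum input `h263` of `offDiag_hasMajorant` on `geomTB D` — from p21's `lemma21_torus`
with the constant `c = K261 N₀ (d+1) L 1 (¼δ)` for every member with `L·M_h ≥ N₀ + 1` (`N₀ = ⌈8(d+1)L/δ⌉ + 1` makes the (2.59)-shape ratio `< 1`); the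
SAME constant as the box lineage (`…B6Ineq2134ThetaKLevel.ineq263_geoB`). [cite: Balaban1984PropagatorsII, Lemma 2.1 (2.63) p.234, (2.59) p.233] -/
theorem ineq263_geomTB (d ℓ : ℕ) {δ : ℝ} (hδ : 0 < δ) :
    ∃ N₀ : ℕ, 0 < N₀ ∧ ∀ {Mh k R : ℕ} {P : Fin (d + 1) → ℕ} (D : B6MultiLevelTorusOperatorL0.TDomains d ℓ Mh k P R), 1 ≤ Mh → (∀ μ, 1 ≤ P μ) → 2 * (ℓ + 1) ≤ R →
      (N₀ : ℝ) + 1 ≤ ((ℓ : ℝ) + 1) * Mh →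
      Ineq263With (K261 N₀ (d + 1) ((ℓ : ℝ) + 1) 1 (1 / 3 * (3 / 4 * δ))) (geomTB D) (3 / 4 * δ) (1 / 3) := by
  have hL0 : (0 : ℝ) < (ℓ : ℝ) + 1 := by positivity
  have hlog : Real.log ((ℓ : ℝ) + 1) ≤ (ℓ : ℝ) + 1 := (Real.log_le_sub_one_of_pos hL0).trans (by linarith)
  obtain ⟨N₀, hN₀⟩ : ∃ N₀ : ℕ, N₀ = ⌈8 * ((d : ℝ) + 1) * ((ℓ : ℝ) + 1) / δ⌉₊ + 1 := ⟨_, rfl⟩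
  have hN₀pos : 0 < N₀ := by rw [hN₀]; omega
  have hN₀ge : 8 * ((d : ℝ) + 1) * ((ℓ : ℝ) + 1) < δ * (N₀ : ℝ) := by
    have h : 8 * ((d : ℝ) + 1) * ((ℓ : ℝ) + 1) / δ < (N₀ : ℝ) := by
      rw [hN₀]; push_cast; exact lt_of_le_of_lt (Nat.le_ceil _) (by linarith)
    rw [div_lt_iff₀ hδ] at h; linarith
  have hθ : Real.exp (-(1 / 3 * (3 / 4 * δ))) * ((ℓ : ℝ) + 1) ^ ((2 * (d + 1 : ℕ) : ℝ) / N₀) < 1 := by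
    refine theta_lt_one_of_log hL0 hN₀pos ?_
    push_cast
    have h1 := mul_le_mul_of_nonneg_left hlog (by positivity : (0 : ℝ) ≤ 2 * ((d : ℝ) + 1))
    linarith
  refine ⟨N₀, hN₀pos, fun D hMh hP hR hM => ?_⟩
  obtain ⟨-, -, -, h263⟩ := lemma21_torus D hMh hP hN₀pos (walk_threshold hR N₀ hM) (δ₀ := 3 / 4 * δ) (α := 1 / 3)
    (by positivity) (by norm_num) (by norm_num) hθ
  exact fun m y y' => h263 m y y'

/-- **THE LARGENESS `L² ≤ e^{⅛δ·RM}` ON THE TORUS** (hypothesis `hthr` of `offDiag_hasMajorant`) for every member with `L·M_h ≥ N₂ + 1`, `N₂ = ⌈16L/δ⌉`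
(`RM = R·L·M_h − 1 ≥ N₂`). [cite: Balaban1984PropagatorsII, (2.68) p.235 (remarks), (2.59) p.233] -/
theorem thr_geomTB (d ℓ : ℕ) {δ : ℝ} (hδ : 0 < δ) :
    ∃ N₂ : ℕ, ∀ {Mh k R : ℕ} {P : Fin (d + 1) → ℕ} (D : B6MultiLevelTorusOperatorL0.TDomains d ℓ Mh k P R), 1 ≤ Mh → 2 * (ℓ + 1) ≤ R →
      (N₂ : ℝ) + 1 ≤ ((ℓ : ℝ) + 1) * Mh → (geomTB D).L ^ 2 ≤ Real.exp (1 / 8 * δ * ((geomTB D).R * (geomTB D).M)) := by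
  have hL0 : (0 : ℝ) < (ℓ : ℝ) + 1 := by positivity
  have hlog : Real.log ((ℓ : ℝ) + 1) ≤ (ℓ : ℝ) + 1 := (Real.log_le_sub_one_of_pos hL0).trans (by linarith)
  obtain ⟨N₂, hN₂⟩ : ∃ N₂ : ℕ, N₂ = ⌈16 * ((ℓ : ℝ) + 1) / δ⌉₊ := ⟨_, rfl⟩
  have hN₂ge : 16 * ((ℓ : ℝ) + 1) ≤ δ * (N₂ : ℝ) := by
    have h : 16 * ((ℓ : ℝ) + 1) / δ ≤ (N₂ : ℝ) := by rw [hN₂]; exact Nat.le_ceil _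
    rw [div_le_iff₀ hδ] at h; linarith
  refine ⟨N₂, ?_⟩
  intro Mh k R P D hMh hR hM
  have hR1 : (1 : ℝ) ≤ (R : ℝ) := by
    have : (1 : ℕ) ≤ R := by omega
    exact_mod_cast this
  have hMh0 : (0 : ℝ) ≤ ((ℓ : ℝ) + 1) * Mh := by positivity
  have hge : (N₂ : ℝ) ≤ (geomTB D).R * (geomTB D).M := by
    rw [geomTB_RM D hMh]
    have : ((ℓ : ℝ) + 1) * Mh ≤ (R : ℝ) * (((ℓ : ℝ) + 1) * Mh) := by nlinarith
    linarith
  have hE : 2 * Real.log ((ℓ : ℝ) + 1) ≤ 1 / 8 * δ * ((geomTB D).R * (geomTB D).M) := by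
    have h3 := mul_le_mul_of_nonneg_left hge (by positivity : (0 : ℝ) ≤ 1 / 8 * δ)
    nlinarith
  rw [geomTB_L]
  calc ((ℓ : ℝ) + 1) ^ 2 = Real.exp (Real.log (((ℓ : ℝ) + 1) ^ 2)) := (Real.exp_log (by positivity)).symm
    _ = Real.exp (2 * Real.log ((ℓ : ℝ) + 1)) := by rw [Real.log_pow]; norm_num
    _ ≤ _ := Real.exp_le_exp.2 hE

/-! ## §2  (2.134) for □ ≠ □′ on the torus, `∂P∂*` a displayed hypothesis, `θ₀` explicit -/

/-- monotonicity of a local majorant in the kernel. [folklore] -/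
private theorem localMajorant_mono {g : B6.Geometry} {X : Type} (blk : X → g.Site) {T : Module.End ℝ (X → ℝ)} {S : Set g.Site}
    {K K' : g.Site → g.Site → ℝ} (h : LocalMajorant blk T S K) (hle : ∀ a b, K a b ≤ K' a b) : LocalMajorant blk T S K' :=
  fun y' hy' μ B hμ x hx => (h y' hy' μ B hμ x hx).trans (mul_le_mul_of_nonneg_right (hle _ _) hμ.nonneg)

/-- **(2.134) FOR THE OFF-DIAGONAL PAIRS □ ≠ □′ ON THE TORUS, THE `O(M⁻¹)` EXPLICIT.**  For every rate `δ_G > 0` there are a threshold `M₀` and a constant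
`Θ ≥ 0` (on `d, L, δ_G` only) such that for every genuine nested family `D` on the torus with `L·M_h ≥ M₀` (`M_h ≥ 1`, `P_μ ≥ 1`, `R ≥ 2L`), every fine
lattice `X` with block map `blk`, every `C_P, C_G ≥ 0`, `m > 0`, every operator `Dg` (the global `∂P∂*`) with majorant `C_P(L^j)^{−2}e^{−δ_Gd}` and every
`G_{□′}` with the (2.133)-shape local majorant `C_G(L^j)²e^{−δ_Gd}` on a reach set `S`, partition data `a` (`|a| ≤ 1`, vanishing on the blocks of `Score`),
`hI` (`|hI| ≤ 1`, supported within the blocks of `S`) and the gap `m·M ≤ d(y,y″)` for `y ∉ Score`, `y″ ∈ S`: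
`HasMajorant blk (a·Dg·(hI·G_{□′}·hI)) (Θ·C_P·C_G/(m·M)·e^{−(δ_G/2)d})`, `M = L·M_h` — r03's `offDiag_hasMajorant` + `theta_le` with §1.
[cite: Balaban1984PropagatorsII, (2.134) p.247; (2.88) p.238; (2.93) p.239; Lemma 2.1 p.234] -/
theorem ineq2134_offDiag_torus (d ℓ : ℕ) {δG : ℝ} (hδG : 0 < δG) :
    ∃ M₀ Θ : ℝ, 0 < M₀ ∧ 0 ≤ Θ ∧
      ∀ {Mh k R : ℕ} {P : Fin (d + 1) → ℕ} (D : B6MultiLevelTorusOperatorL0.TDomains d ℓ Mh k P R), 1 ≤ Mh → (∀ μ, 1 ≤ P μ) → 2 * (ℓ + 1) ≤ R →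
        M₀ ≤ ((ℓ : ℝ) + 1) * Mh → ∀ {X : Type} (blk : X → (geomTB D).Site) {CP CG m : ℝ}, 0 ≤ CP → 0 ≤ CG → 0 < m →
        ∀ {Dg Gl : Module.End ℝ (X → ℝ)} {a hI : X → ℝ} {S Score : Set (geomTB D).Site},
          HasMajorant blk Dg (fun y y'' => CP / (geomTB D).len y ^ 2 * Real.exp (-(δG * (geomTB D).dist y y''))) →
          LocalMajorant blk Gl S (fun y'' y' => CG * (geomTB D).len y'' ^ 2 * Real.exp (-(δG * (geomTB D).dist y'' y'))) →
          (∀ x, |a x| ≤ 1) → (∀ x, a x ≠ 0 → blk x ∉ Score) → (∀ x, |hI x| ≤ 1) → (∀ x, hI x ≠ 0 → blk x ∈ S) →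
          (∀ y y'', y ∉ Score → y'' ∈ S → m * (geomTB D).M ≤ (geomTB D).dist y y'') →
          HasMajorant blk (mulOp a * Dg * (mulOp hI * Gl * mulOp hI))
            (fun y y' => Θ * CP * CG / m * ((geomTB D).M)⁻¹ * Real.exp (-(1 / 2 * δG * (geomTB D).dist y y'))) := by
  -- (2.63) at `(¾δ_G, ⅓)`, the largeness threshold, the constants
  obtain ⟨N₀, hN₀pos, h263⟩ := ineq263_geomTB d ℓ hδG
  obtain ⟨N₂, hthr⟩ := thr_geomTB d ℓ hδG
  obtain ⟨c, hc⟩ : ∃ c : ℝ, c = K261 N₀ (d + 1) ((ℓ : ℝ) + 1) 1 (1 / 3 * (3 / 4 * δG)) := ⟨_, rfl⟩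
  obtain ⟨M₀, hM₀⟩ : ∃ M₀ : ℝ, M₀ = max ((N₀ : ℝ) + 1) ((N₂ : ℝ) + 1) := ⟨_, rfl⟩
  obtain ⟨Θ, hΘ⟩ : ∃ Θ : ℝ, Θ = 8 * ((ℓ : ℝ) + 1) ^ 2 * c ^ 2 / δG := ⟨_, rfl⟩
  have hΘnn : 0 ≤ Θ := by rw [hΘ]; positivity
  refine ⟨M₀, Θ, by rw [hM₀]; exact lt_max_of_lt_left (by positivity), hΘnn, ?_⟩
  intro Mh k R P D hMh hP hR hM X blk CP CG m hCP hCG hm Dg Gl a hI S Score hDg hG ha1 haS hI1 hIS hgap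
  have hMN₀ : (N₀ : ℝ) + 1 ≤ ((ℓ : ℝ) + 1) * Mh := (le_max_left _ _).trans (hM₀ ▸ hM)
  have hMN₂ : (N₂ : ℝ) + 1 ≤ ((ℓ : ℝ) + 1) * Mh := (le_max_right _ _).trans (hM₀ ▸ hM)
  have hMpos := M_pos_TB D hMh
  have h263D : Ineq263With c (geomTB D) (3 / 4 * δG) (1 / 3) := by rw [hc]; exact h263 D hMh hP hR hMN₀
  have key := offDiag_hasMajorant blk (one_le_L_TB D) (eta_pos_TB D) (levelSepTB D hMh hP (one_le_RLMh hMh hR)) (dist_nonneg_TB D hMh hP)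
    hδG.le hCP hCG (RM_nonneg_TB D hMh hR) (hthr D hMh hR hMN₂) h263D hDg hG ha1 haS hI1 hIS hgap
  -- `θ = C_P·C_G·L²·c²·e^{−⅛δ mM} ≤ Θ·C_P·C_G/(m·M)` (r03's `theta_le`)
  refine hasMajorant_mono _ key fun y y' => ?_
  have hθ := theta_le (L := (geomTB D).L) (c := c) hδG hm hMpos hCP hCG
  have hid : 8 * CP * CG * (geomTB D).L ^ 2 * c ^ 2 / (δG * m) = Θ * CP * CG / m := by rw [hΘ, geomTB_L]; field_simp
  rw [hid] at hθ
  exact mul_le_mul_of_nonneg_right hθ (Real.exp_nonneg _)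

/-- algebra of multiplication operators: `h_□·h_□·(1 − ζ_{□′}) = (h_□²(1 − ζ_{□′}))·` as operators. [folklore] -/
private theorem mulOp_mul_mulOp_one_sub {X : Type} (h z : X → ℝ) : mulOp h * mulOp h * (1 - mulOp z) = mulOp (fun x => h x * h x * (1 - z x)) := by
  refine LinearMap.ext fun v => funext fun x => ?_
  simp only [Module.End.mul_apply, LinearMap.sub_apply, Module.End.one_apply, Pi.sub_apply, mulOp_apply]
  ring

/-- `|h| ≤ 1`, `0 ≤ ζ ≤ 1` give `|h²(1 − ζ)| ≤ 1`. [cite: Balaban1984PropagatorsII, (2.36) p.229, (2.93) p.239, bookkeeping] -/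
private theorem abs_sq_one_sub_le {h z : ℝ} (hh : |h| ≤ 1) (hz0 : 0 ≤ z) (hz1 : z ≤ 1) : |h * h * (1 - z)| ≤ 1 := by
  rw [abs_mul, abs_mul, abs_of_nonneg (by linarith : (0 : ℝ) ≤ 1 - z)]
  nlinarith [abs_nonneg h, mul_nonneg (abs_nonneg h) (abs_nonneg h)]

/-- **(2.134) ON THE TORUS FOR `K_{□,□′}G_{□′}h_{□′}` WITH `K_{□,□′} = h_□²(1 − ζ_{□′})∂P∂*h_{□′}` OF (2.93) BY NAME** (`…B6Eq291Generator.kOff`), the global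
`∂P∂*` a displayed hypothesis `hDg`: under `|h_□| ≤ 1`, `0 ≤ ζ_{□′} ≤ 1` with `ζ_{□′} = 1` on the blocks of `Score`, `|h_{□′}| ≤ 1` supported within the
blocks of `S`, the gap `m·M` and the (2.133)-shape local majorant of `G_{□′}` — for all members above ONE threshold:
`HasMajorant blk ((K_{□,□′}·G_{□′})·h_{□′}) (θ₀·e^{−(δ_G/2)d(y,y′)})`, `θ₀ = Θ·C_P·C_G/(m·M)` — the hypothesis `h2134` of
`…B6Prop26Gluing.majorant_R_of_2134` / r03's `B6GlobalChartV1.prop26_2136_V1_of_2134_eq291` for the pair (□, □′), ON THE TORUS.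
[cite: Balaban1984PropagatorsII, (2.134) p.247; (2.93) p.239; (2.36) p.229] -/
theorem ineq2134_kOff_torus (d ℓ : ℕ) {δG : ℝ} (hδG : 0 < δG) :
    ∃ M₀ Θ : ℝ, 0 < M₀ ∧ 0 ≤ Θ ∧
      ∀ {Mh k R : ℕ} {P : Fin (d + 1) → ℕ} (D : B6MultiLevelTorusOperatorL0.TDomains d ℓ Mh k P R), 1 ≤ Mh → (∀ μ, 1 ≤ P μ) → 2 * (ℓ + 1) ≤ R →
        M₀ ≤ ((ℓ : ℝ) + 1) * Mh → ∀ {X : Type} (blk : X → (geomTB D).Site) {CP CG m : ℝ}, 0 ≤ CP → 0 ≤ CG → 0 < m →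
        ∀ {Dg Gl : Module.End ℝ (X → ℝ)} {h z h' : X → ℝ} {S Score : Set (geomTB D).Site},
          HasMajorant blk Dg (fun y y'' => CP / (geomTB D).len y ^ 2 * Real.exp (-(δG * (geomTB D).dist y y''))) →
          LocalMajorant blk Gl S (fun y'' y' => CG * (geomTB D).len y'' ^ 2 * Real.exp (-(δG * (geomTB D).dist y'' y'))) →
          (∀ x, |h x| ≤ 1) → (∀ x, 0 ≤ z x) → (∀ x, z x ≤ 1) → (∀ x, z x ≠ 1 → blk x ∉ Score) →
          (∀ x, |h' x| ≤ 1) → (∀ x, h' x ≠ 0 → blk x ∈ S) →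
          (∀ y y'', y ∉ Score → y'' ∈ S → m * (geomTB D).M ≤ (geomTB D).dist y y'') →
          HasMajorant blk ((kOff Dg (mulOp h) (mulOp z) (mulOp h') * Gl) * mulOp h')
            (fun y y' => Θ * CP * CG / m * ((geomTB D).M)⁻¹ * Real.exp (-(δG / 2 * (geomTB D).dist y y'))) := by
  obtain ⟨M₀, Θ, hM₀, hΘ, hall⟩ := ineq2134_offDiag_torus d ℓ hδG
  refine ⟨M₀, Θ, hM₀, hΘ, ?_⟩
  intro Mh k R P D hMh hP hR hM X blk CP CG m hCP hCG hm Dg Gl h z h' S Score hDg hG hh hz0 hz1 hzS hh' hh'S hgap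
  have ha1 : ∀ x, |h x * h x * (1 - z x)| ≤ 1 := fun x => abs_sq_one_sub_le (hh x) (hz0 x) (hz1 x)
  have haS : ∀ x, h x * h x * (1 - z x) ≠ 0 → blk x ∉ Score := fun x hx =>
    hzS x fun hz => hx (by rw [hz, sub_self, mul_zero])
  have key := hall D hMh hP hR hM blk hCP hCG hm (Dg := Dg) (Gl := Gl) (S := S) hDg hG ha1 haS hh' hh'S hgap
  have e : (kOff Dg (mulOp h) (mulOp z) (mulOp h') * Gl) * mulOp h' =
      mulOp (fun x => h x * h x * (1 - z x)) * Dg * (mulOp h' * Gl * mulOp h') := by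
    unfold kOff
    rw [mulOp_mul_mulOp_one_sub]
    simp only [mul_assoc]
  rw [e]
  refine hasMajorant_mono _ key fun y y' => le_of_eq ?_
  congr 2
  ring

/-! ## §3  The displayed threshold on the torus: `N²θ₀c₁ < 1` for `M ≥ M₁` -/

/-- **(2.134) ON THE TORUS WITH ITS SMALLNESS, ABOVE ONE THRESHOLD**: for `δ_G > 0`, `C_P, C_G ≥ 0`, `m > 0`, an overlap number `N` and a walk constant
`c₁ ≥ 0` there are `M₁`, `Θ ≥ 0` such that every member with `L·M_h ≥ M₁` has BOTH `N²·θ₀·c₁ < 1` AND the majorant `θ₀·e^{−(δ_G/2)d}` of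
`K_{□,□′}G_{□′}h_{□′}` (□ ≠ □′), `θ₀ = Θ·C_P·C_G/(m·M)` — the inputs `hsmall` and `h2134` (off-diagonal pairs) of `…B6Prop26Gluing.prop26_2136_of_2133_2134`
on the torus (gen 24's `theta0_lt` by name). [cite: Balaban1984PropagatorsII, (2.134)–(2.135) p.247, Prop. 2.6 p.247] -/
theorem ineq2134_kOff_torus_small (d ℓ : ℕ) {δG CP CG m c₁ : ℝ} (N : ℕ) (hδG : 0 < δG) (hCP : 0 ≤ CP) (hCG : 0 ≤ CG) (hm : 0 < m)
    (hc₁ : 0 ≤ c₁) :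
    ∃ M₁ Θ : ℝ, 0 < M₁ ∧ 0 ≤ Θ ∧
      ∀ {Mh k R : ℕ} {P : Fin (d + 1) → ℕ} (D : B6MultiLevelTorusOperatorL0.TDomains d ℓ Mh k P R), 1 ≤ Mh → (∀ μ, 1 ≤ P μ) → 2 * (ℓ + 1) ≤ R →
        M₁ ≤ ((ℓ : ℝ) + 1) * Mh →
        (N : ℝ) ^ 2 * (Θ * CP * CG / m * ((geomTB D).M)⁻¹) * c₁ < 1 ∧
        ∀ {X : Type} (blk : X → (geomTB D).Site) {Dg Gl : Module.End ℝ (X → ℝ)} {h z h' : X → ℝ} {S Score : Set (geomTB D).Site},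
          HasMajorant blk Dg (fun y y'' => CP / (geomTB D).len y ^ 2 * Real.exp (-(δG * (geomTB D).dist y y''))) →
          LocalMajorant blk Gl S (fun y'' y' => CG * (geomTB D).len y'' ^ 2 * Real.exp (-(δG * (geomTB D).dist y'' y'))) →
          (∀ x, |h x| ≤ 1) → (∀ x, 0 ≤ z x) → (∀ x, z x ≤ 1) → (∀ x, z x ≠ 1 → blk x ∉ Score) →
          (∀ x, |h' x| ≤ 1) → (∀ x, h' x ≠ 0 → blk x ∈ S) →
          (∀ y y'', y ∉ Score → y'' ∈ S → m * (geomTB D).M ≤ (geomTB D).dist y y'') →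
          HasMajorant blk ((kOff Dg (mulOp h) (mulOp z) (mulOp h') * Gl) * mulOp h')
            (fun y y' => Θ * CP * CG / m * ((geomTB D).M)⁻¹ * Real.exp (-(δG / 2 * (geomTB D).dist y y'))) := by
  obtain ⟨M₀, Θ, hM₀, hΘ, hall⟩ := ineq2134_kOff_torus d ℓ hδG
  obtain ⟨M₂, hM₂, hsmall⟩ := theta0_lt (Θ := Θ * CP) (CG := CG) N (mul_nonneg hΘ hCP) hCG hm hc₁ zero_lt_one
  refine ⟨max M₀ M₂, Θ, lt_max_of_lt_left hM₀, hΘ, fun D hMh hP hR hM => ⟨?_, ?_⟩⟩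
  · have hMD : M₂ ≤ (geomTB D).M := by rw [geomTB_M]; exact (le_max_right _ _).trans hM
    have := hsmall _ hMD
    simpa only [mul_assoc, mul_div_assoc] using this
  · intro X blk Dg Gl h z h' S Score hDg hG hh hz0 hz1 hzS hh' hh'S hgap
    exact hall D hMh hP hR ((le_max_left _ _).trans hM) blk hCP hCG hm hDg hG hh hz0 hz1 hzS hh' hh'S hgap

end Literature.MathematicalPhysics.QuantumFieldTheory.Balaban1983to89.B6Ineq2134KLevelTorusL0
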